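import Mathlib
import Summits.Ventures.PercRepro2.Defs
import Summits.Ventures.PercRepro2.Graph

/-!
# (G4-u), the coin class: a marked vertex `b` of degree two between the roots — the dead-end lemmas
(blind cell PercRepro2, p4 g15; S3 (G4-u) item (ab))

The class «`b` adjacent exactly to `{a₂, u}`»: `b` carries exactly the two edges `f₁ = {b, a₂}` and
`f₂ = {b, u}`.  Unless BOTH are open, `b` is a dead end — no path between two other vertices passes
through it — so every connection among the other vertices is the same as in the configuration
`Function.update (Function.update ω f₁ false) f₂ false` with both `b`-edges closed, and `b` itself is reached from `x ≠ b` exactly through an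
open `b`-edge whose other end `x` reaches in `Function.update (Function.update ω f₁ false) f₂ false`:

* `conn_iff_off`: for `x, y ≠ b` and `¬(ω f₁ ∧ ω f₂)`, `x ↔ y` in `ω` iff in `Function.update (Function.update ω f₁ false) f₂ false`;
* `conn_b_iff`: for `x ≠ b`, `x ↔ b` iff (`f₁` open and `x ↔ a₂` off) or (`f₂` open and `x ↔ u` off);
* `conn_u_a2_of_both`: both open ⟹ `u ↔ a₂` (so on `Q = {u ↮ a₂}` the two coins are never both open).

Proofs by the closure lemma `mem_of_conn_of_closed` of Graph.lean.  No probability here.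
-/

namespace Summit.Ventures.PercRepro2

namespace RootLeafU

namespace Coin

variable {V : Type*} {E : Type*} [DecidableEq E]

/-- Closing the `b`-edges does not change the other edges. -/
lemma off_apply_of_ne {f₁ f₂ e : E} (h1 : e ≠ f₁) (h2 : e ≠ f₂) (ω : Config E) :
    Function.update (Function.update ω f₁ false) f₂ false e = ω e := by
  simp [Function.update_of_ne h1, Function.update_of_ne h2]

/-- `f₁` is closed. -/
@[simp] lemma off_f₁ (f₁ f₂ : E) (ω : Config E) : Function.update (Function.update ω f₁ false) f₂ false f₁ = false := by
  by_cases h : f₁ = f₂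
  · subst h; simp
  · simp [Function.update_of_ne h]

/-- `f₂` is closed. -/
@[simp] lemma off_f₂ (f₁ f₂ : E) (ω : Config E) : Function.update (Function.update ω f₁ false) f₂ false f₂ = false := by
  simp

/-- Closing edges decreases the configuration. -/
lemma off_le (f₁ f₂ : E) (ω : Config E) : Function.update (Function.update ω f₁ false) f₂ false ≤ ω := by
  intro e
  by_cases h1 : e = f₁
  · subst h1; simp
  by_cases h2 : e = f₂
  · subst h2; simp
  rw [off_apply_of_ne h1 h2]

/-- The closed-off configuration only depends on the edges other than `f₁, f₂`. -/
lemma off_eq_of_eqOn {f₁ f₂ : E} {ω ω' : Config E} (h : ∀ e, e ≠ f₁ → e ≠ f₂ → ω e = ω' e) :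
    Function.update (Function.update ω f₁ false) f₂ false = Function.update (Function.update ω' f₁ false) f₂ false := by
  funext e
  by_cases h1 : e = f₁
  · subst h1; simp
  by_cases h2 : e = f₂
  · subst h2; simp
  rw [off_apply_of_ne h1 h2, off_apply_of_ne h1 h2, h e h1 h2]

section DeadEnd

variable {ends : E → Sym2 V} {b a₂ u : V} {f₁ f₂ : E}

omit [DecidableEq E] in
/-- Open adjacency from `b` (whose edges are `f₁ = {b, a₂}` and `f₂ = {b, u}`) goes to `a₂` through
an open `f₁` or to `u` through an open `f₂`. -/
lemma openAdj_coin (hf₁ : ends f₁ = s(b, a₂)) (hf₂ : ends f₂ = s(b, u))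
    (hb2 : ∀ e, b ∈ ends e → e = f₁ ∨ e = f₂) (hba : b ≠ a₂) (hbu : b ≠ u) {ω : Config E} {y : V}
    (h : OpenAdj ends ω b y) : (ω f₁ = true ∧ y = a₂) ∨ (ω f₂ = true ∧ y = u) := by
  obtain ⟨e, he, hends⟩ := h
  rcases hb2 e (by rw [hends]; exact Sym2.mem_mk_left b y) with rfl | rfl
  · left
    refine ⟨he, ?_⟩
    rw [hf₁, Sym2.eq_iff] at hends
    rcases hends with ⟨_, h2⟩ | ⟨_, h2⟩
    · exact h2.symm
    · exact absurd h2.symm hba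
  · right
    refine ⟨he, ?_⟩
    rw [hf₂, Sym2.eq_iff] at hends
    rcases hends with ⟨_, h2⟩ | ⟨_, h2⟩
    · exact h2.symm
    · exact absurd h2.symm hbu

omit [DecidableEq E] in
/-- An edge between two vertices other than `b` is not a `b`-edge. -/
lemma ne_coin_of_ends {e : E} {y z : V} (hy : y ≠ b) (hz : z ≠ b) (hends : ends e = s(y, z))
    (hf₁ : ends f₁ = s(b, a₂)) (hf₂ : ends f₂ = s(b, u)) : e ≠ f₁ ∧ e ≠ f₂ := by
  constructor
  · rintro rfl
    rw [hf₁, Sym2.eq_iff] at hends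
    rcases hends with ⟨h1, _⟩ | ⟨h1, _⟩
    · exact hy h1.symm
    · exact hz h1.symm
  · rintro rfl
    rw [hf₂, Sym2.eq_iff] at hends
    rcases hends with ⟨h1, _⟩ | ⟨h1, _⟩
    · exact hy h1.symm
    · exact hz h1.symm

/-- Open adjacency between vertices other than `b` survives closing the `b`-edges. -/
lemma openAdj_off_of_openAdj (hf₁ : ends f₁ = s(b, a₂)) (hf₂ : ends f₂ = s(b, u)) {ω : Config E}
    {y z : V} (hy : y ≠ b) (hz : z ≠ b) (h : OpenAdj ends ω y z) :
    OpenAdj ends (Function.update (Function.update ω f₁ false) f₂ false) y z := by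
  obtain ⟨e, he, hends⟩ := h
  obtain ⟨h1, h2⟩ := ne_coin_of_ends hy hz hends hf₁ hf₂
  exact ⟨e, by rw [off_apply_of_ne h1 h2, he], hends⟩

omit [DecidableEq E] in
/-- Both `b`-edges open: `u ↔ a₂` through `b`. -/
lemma conn_u_a2_of_both (hf₁ : ends f₁ = s(b, a₂)) (hf₂ : ends f₂ = s(b, u)) {ω : Config E}
    (h : ω f₁ = true ∧ ω f₂ = true) : Conn ends ω u a₂ := by
  have h1 : Conn ends ω u b := conn_of_openAdj ⟨f₂, h.2, by rw [hf₂, Sym2.eq_swap]⟩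
  have h2 : Conn ends ω b a₂ := conn_of_openAdj ⟨f₁, h.1, hf₁⟩
  exact conn_trans h1 h2

/-- **The dead-end closure**: with not both `b`-edges open, everything `x ≠ b` reaches is, if `≠ b`,
reached with the `b`-edges closed; and `b` itself only through an open `b`-edge. -/
theorem conn_off_of_conn (hf₁ : ends f₁ = s(b, a₂)) (hf₂ : ends f₂ = s(b, u))
    (hb2 : ∀ e, b ∈ ends e → e = f₁ ∨ e = f₂) (hba : b ≠ a₂) (hbu : b ≠ u) {ω : Config E}
    (hnb : ¬ (ω f₁ = true ∧ ω f₂ = true)) {x : V} (hx : x ≠ b) {y : V} (h : Conn ends ω x y) :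
    (y ≠ b → Conn ends (Function.update (Function.update ω f₁ false) f₂ false) x y) ∧
      (y = b → (ω f₁ = true → Conn ends (Function.update (Function.update ω f₁ false) f₂ false) x a₂) ∧
        (ω f₂ = true → Conn ends (Function.update (Function.update ω f₁ false) f₂ false) x u)) := by
  let S : Set V := {y | (y ≠ b → Conn ends (Function.update (Function.update ω f₁ false) f₂ false) x y) ∧
      (y = b → (ω f₁ = true → Conn ends (Function.update (Function.update ω f₁ false) f₂ false) x a₂) ∧
        (ω f₂ = true → Conn ends (Function.update (Function.update ω f₁ false) f₂ false) x u))}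
  have hxS : x ∈ S := by
    refine ⟨fun _ => conn_refl _ _ _, fun hxb => absurd hxb hx⟩
  have hS : ∀ y ∈ S, ∀ z, (openGraph ends ω).Adj y z → z ∈ S := by
    intro y hy z hyz
    obtain ⟨hne, hadj⟩ := openGraph_adj.1 hyz
    by_cases hyb : y = b
    · -- `y = b`: the edge to `z` is an open `b`-edge
      subst hyb
      have hzb : z ≠ y := fun h => hne h.symm
      rcases openAdj_coin hf₁ hf₂ hb2 hba hbu hadj with ⟨ho, rfl⟩ | ⟨ho, rfl⟩
      · exact ⟨fun _ => (hy.2 rfl).1 ho, fun h => absurd h hzb⟩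
      · exact ⟨fun _ => (hy.2 rfl).2 ho, fun h => absurd h hzb⟩
    · have hyc : Conn ends (Function.update (Function.update ω f₁ false) f₂ false) x y := hy.1 hyb
      by_cases hzb : z = b
      · -- `y ≠ b`, `z = b`: the edge `y b` is `f₁` (then `y = a₂`) or `f₂` (then `y = u`)
        subst hzb
        rcases openAdj_coin hf₁ hf₂ hb2 hba hbu hadj.symm with ⟨ho, rfl⟩ | ⟨ho, rfl⟩
        · refine ⟨fun h => absurd rfl h, fun _ => ⟨fun _ => hyc, fun h2 => absurd ⟨ho, h2⟩ hnb⟩⟩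
        · refine ⟨fun h => absurd rfl h, fun _ => ⟨fun h1 => absurd ⟨h1, ho⟩ hnb, fun _ => hyc⟩⟩
      · -- neither is `b`: the edge survives `off`
        have := openAdj_off_of_openAdj hf₁ hf₂ hyb hzb hadj
        exact ⟨fun _ => conn_trans hyc (conn_of_openAdj this), fun h => absurd h hzb⟩
  exact mem_of_conn_of_closed hS hxS h

/-- For `x, y ≠ b` and not both `b`-edges open, `x ↔ y` iff `x ↔ y` with the `b`-edges closed. -/
theorem conn_iff_off (hf₁ : ends f₁ = s(b, a₂)) (hf₂ : ends f₂ = s(b, u))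
    (hb2 : ∀ e, b ∈ ends e → e = f₁ ∨ e = f₂) (hba : b ≠ a₂) (hbu : b ≠ u) {ω : Config E}
    (hnb : ¬ (ω f₁ = true ∧ ω f₂ = true)) {x y : V} (hx : x ≠ b) (hy : y ≠ b) :
    Conn ends ω x y ↔ Conn ends (Function.update (Function.update ω f₁ false) f₂ false) x y :=
  ⟨fun h => (conn_off_of_conn hf₁ hf₂ hb2 hba hbu hnb hx h).1 hy,
    fun h => conn_mono (off_le f₁ f₂ ω) h⟩

/-- For `x ≠ b` and not both `b`-edges open, `x ↔ b` iff `x` reaches `b` through an open `b`-edge. -/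
theorem conn_b_iff (hf₁ : ends f₁ = s(b, a₂)) (hf₂ : ends f₂ = s(b, u))
    (hb2 : ∀ e, b ∈ ends e → e = f₁ ∨ e = f₂) (hba : b ≠ a₂) (hbu : b ≠ u) {ω : Config E}
    (hnb : ¬ (ω f₁ = true ∧ ω f₂ = true)) {x : V} (hx : x ≠ b) :
    Conn ends ω x b ↔
      (ω f₁ = true ∧ Conn ends (Function.update (Function.update ω f₁ false) f₂ false) x a₂) ∨ (ω f₂ = true ∧ Conn ends (Function.update (Function.update ω f₁ false) f₂ false) x u) := by
  constructor
  · intro h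
    have hc := (conn_off_of_conn hf₁ hf₂ hb2 hba hbu hnb hx h).2 rfl
    -- `b` is reached, so some `b`-edge is open
    by_cases h1 : ω f₁ = true
    · exact Or.inl ⟨h1, hc.1 h1⟩
    by_cases h2 : ω f₂ = true
    · exact Or.inr ⟨h2, hc.2 h2⟩
    · -- both closed: `b` is isolated, contradicting `x ↔ b` with `x ≠ b`
      exfalso
      have hS : ∀ y ∈ ({b} : Set V), ∀ z, (openGraph ends ω).Adj y z → z ∈ ({b} : Set V) := by
        intro y hy z hyz
        rw [Set.mem_singleton_iff] at hy
        subst hy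
        obtain ⟨_, hadj⟩ := openGraph_adj.1 hyz
        rcases openAdj_coin hf₁ hf₂ hb2 hba hbu hadj with ⟨ho, _⟩ | ⟨ho, _⟩
        · exact absurd ho h1
        · exact absurd ho h2
      exact hx (mem_of_conn_of_closed hS rfl (conn_symm h))
  · rintro (⟨h1, hc⟩ | ⟨h2, hc⟩)
    · exact conn_trans (conn_mono (off_le f₁ f₂ ω) hc) (conn_of_openAdj ⟨f₁, h1, by rw [hf₁, Sym2.eq_swap]⟩)
    · exact conn_trans (conn_mono (off_le f₁ f₂ ω) hc) (conn_of_openAdj ⟨f₂, h2, by rw [hf₂, Sym2.eq_swap]⟩)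

end DeadEnd

end Coin

end RootLeafU

end Summit.Ventures.PercRepro2
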